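import Literature.Probability.RandomPlanarGeometry.SLEKappaRhoSchemeDriver
import Literature.Probability.RandomPlanarGeometry.SLEKappaRhoJetMeasurable
import Literature.Probability.RandomPlanarGeometry.SLEKappaRhoDriftGlue
import Literature.Probability.RandomPlanarGeometry.SLEKappaRhoSlidArc
import HarnessLib

/-!
# The processes of [LSW] Lemma 8.9 for SLE(8/3, ρ): `M_t` and the jets of `log M_t` as adapted processes

G. F. Lawler, O. Schramm, W. Werner, *Conformal restriction: the chordal case*, J. Amer. Math.
Soc. **16** (2003) 917–955 (**[LSW]**), §8.4: `M_t = h_t'(W_t)^{5/8} h_t'(O_t)^b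
[(h_t(W_t) − h_t(O_t))/(W_t − O_t)]^c` ("when `W_t = O_t`, we take `M_t = h_t'(W_t)^{(5/8)+b+c}`"),
and the coefficients of its Itô expansion (proof of Lemma 8.9). Along the everywhere-continuous
driver `drvC J ρ c` of `SLEKappaRhoSchemeDriver` (slid hull `B_t = A_t − W_t`, relative position
`o_t = O_t − W_t` read through `oposC`) we define, with the indicator of the alive event:

* `SLEKappaRho.Yc` — **`M_t` clamped to `[0, 1]`** (`= M_t` before `T_A` by Lemma 8.10), ADAPTED
  (`adapted_Yc`: on the alive event `M_t` is an explicit function of `Φ'_{B_t}(0)`,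
  `E_{B_t}'(o_t)`, `E_{B_t}(o_t)` and `o_t`, `IsPlusHull.oneSidedM_eq_starMap`, all measurable by
  `SLEKappaRhoHullMeasurable`);
* `SLEKappaRho.jL1`, `jL2`, `jM1` — **the jets `∂ₓℓ, ∂ₓ²ℓ, ∂_yℓ` of `log M` at `(0, o_t)`**, the
  first two ADAPTED (`SLEKappaRhoJetMeasurable`);
* `SLEKappaRho.jLam ρ₀` — the `dt`-coefficient `λ = lam E_{B_t} D ρ 0 o_t` with the glued drift
  function `D = glueDrift B_t ρ₀` (`SLEKappaRhoDriftGlue`);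

and record their locality in the truncation level (they only depend on the driving path up to
time `t`).

No named facts.
-/

noncomputable section

open Set Filter Metric Function MeasureTheory
open _root_.Complex _root_.Topology
open scoped NNReal ENNReal
open Literature.Probability.Process

namespace Literature.Probability.RandomPlanarGeometry

namespace SLEKappaRho

open Loewner

variable {J : ℝ≥0 → (ℝ≥0 → ℝ) → ℝ} {ρ : ℝ} {A : Set ℂ} {c : ℝ≥0}

/-! ### The alive event and the slid hull along the driver -/

/-- The alive event at time `t`: the closed hulls of the driver miss `A`. [folklore] -/
def aliveEv (J : ℝ≥0 → (ℝ≥0 → ℝ) → ℝ) (ρ : ℝ) (A : Set ℂ) (c : ℝ≥0) (t : ℝ≥0) : Set (ℝ≥0 → ℝ) :=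
  {ω | Disjoint (closedHull (drvPath J ρ c ω) t) A}

/-- Membership in the alive event. [folklore] -/
theorem mem_aliveEv_iff {t : ℝ≥0} {ω : ℝ≥0 → ℝ} : ω ∈ aliveEv J ρ A c t ↔ Disjoint (closedHull (drvPath J ρ c ω) t) A := Iff.rfl

/-- The alive event is `𝓕_t`-measurable. [folklore] -/
theorem measurableSet_aliveEv (hJ : IsStronglyProgressive brownianFiltration J) (hA : IsStarHull A) (hne : A.Nonempty)
    (t : ℝ≥0) : MeasurableSet[brownianFiltration t] (aliveEv J ρ A c t) :=
  measurableSet_disjoint_closedHull (mΩ := brownianFiltration t) (W := drvPath J ρ c) (fun ω ↦ continuous_drvPath ω)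
    (fun ω ↦ drvPath_zero ω) (fun _ hs ↦ measurable_drvC_of_le hJ hs) hA hne

/-- The slid hull along the driver. [folklore] -/
abbrev hullC (J : ℝ≥0 → (ℝ≥0 → ℝ) → ℝ) (ρ : ℝ) (A : Set ℂ) (c : ℝ≥0) (t : ℝ≥0) (ω : ℝ≥0 → ℝ) : Set ℂ :=
  slidHull (drvPath J ρ c ω) A t

/-- On the alive event the slid hull is a `+`-hull. [folklore] -/
theorem isPlusHull_hullC (hA : IsPlusHull A) {t : ℝ≥0} {ω : ℝ≥0 → ℝ} (hω : ω ∈ aliveEv J ρ A c t) :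
    IsPlusHull (hullC J ρ A c t ω) :=
  isPlusHull_slidHull_of_disjoint (continuous_drvPath ω) (drvPath_zero ω) hA hω

/-! ### `M_t` as an adapted process -/

/-- **[LSW]'s `M_t` read along the driver, times the alive indicator** (value `0` when dead).
[cite: LawlerSchrammWerner2003Restriction, §8.4 (definition of M_t)] -/
def Mraw (J : ℝ≥0 → (ℝ≥0 → ℝ) → ℝ) (ρ : ℝ) (A : Set ℂ) (c : ℝ≥0) (t : ℝ≥0) (ω : ℝ≥0 → ℝ) : ℝ :=
  (aliveEv J ρ A c t).indicator (fun ω ↦ oneSidedM ρ (hullC J ρ A c t ω) (oposC J ρ c t ω)) ω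

/-- **The candidate martingale `Y = (M ∨ 0) ∧ 1`** (the clamping is inactive before `T_A`).
[cite: LawlerSchrammWerner2003Restriction, §8.4 (M_t) and Lemma 8.10 (M_t ≤ 1)] -/
def Yc (J : ℝ≥0 → (ℝ≥0 → ℝ) → ℝ) (ρ : ℝ) (A : Set ℂ) (c : ℝ≥0) (t : ℝ≥0) (ω : ℝ≥0 → ℝ) : ℝ :=
  max 0 (min 1 (Mraw J ρ A c t ω))

/-- `Y ∈ [0, 1]`. [folklore] -/
theorem Yc_mem_Icc (t : ℝ≥0) (ω : ℝ≥0 → ℝ) : Yc J ρ A c t ω ∈ Icc (0 : ℝ) 1 :=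
  ⟨le_max_left _ _, max_le zero_le_one (min_le_left _ _)⟩

/-- `Y = M` whenever `M ∈ [0, 1]`. [folklore] -/
theorem Yc_eq_of_mem {t : ℝ≥0} {ω : ℝ≥0 → ℝ} (h : Mraw J ρ A c t ω ∈ Icc (0 : ℝ) 1) : Yc J ρ A c t ω = Mraw J ρ A c t ω := by
  rw [Yc, min_eq_right h.2, max_eq_right h.1]

/-- **The explicit form of `M` on the alive event**: a measurable function of
`(𝟙{alive}, Φ'_{B_t}(0), E'(o), E(o), o)`. [folklore] -/
theorem Mraw_eq_formula (hA : IsPlusHull A) (t : ℝ≥0) (ω : ℝ≥0 → ℝ) :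
    Mraw J ρ A c t ω =
      (aliveEv J ρ A c t).indicator (fun _ ↦ (1 : ℝ)) ω *
        (if oposC J ρ c t ω < 0 then
          ((aliveEv J ρ A c t).indicator (fun ω ↦ starDeriv (hullC J ρ A c t ω)) ω) ^ (5 / 8 : ℝ) *
            ((aliveEv J ρ A c t).indicator (fun ω ↦ deriv (starMap (hullC J ρ A c t ω)) (oposC J ρ c t ω)) ω).re ^ expB ρ *
            (((aliveEv J ρ A c t).indicator (fun ω ↦ starMap (hullC J ρ A c t ω) (oposC J ρ c t ω)) ω).re / oposC J ρ c t ω) ^ expC ρ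
        else ((aliveEv J ρ A c t).indicator (fun ω ↦ starDeriv (hullC J ρ A c t ω)) ω) ^ sleKappaRhoExponent ρ) := by
  by_cases hω : ω ∈ aliveEv J ρ A c t
  · have hB := isPlusHull_hullC hA hω
    simp only [Mraw, Set.indicator_of_mem hω, one_mul]
    split_ifs with ho
    · exact hB.oneSidedM_eq_starMap ho ρ
    · have ho0 : oposC J ρ c t ω = 0 := le_antisymm (oposC_nonpos t ω) (not_lt.1 ho)
      rw [ho0, oneSidedM_zero, hullDeriv_eq_starDeriv]
  · simp only [Mraw, Set.indicator_of_notMem hω, zero_mul]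

/-- **`M` (times the alive indicator) is `𝓕_t`-measurable.** [folklore] -/
theorem measurable_Mraw (hJ : IsStronglyProgressive brownianFiltration J) (hA : IsPlusHull A) (hne : A.Nonempty) (t : ℝ≥0) :
    Measurable[brownianFiltration t] (Mraw J ρ A c t) := by
  have hcW : ∀ ω, Continuous (drvPath J ρ c ω) := fun ω ↦ continuous_drvPath ω
  have hW0 : ∀ ω, drvPath J ρ c ω 0 = 0 := fun ω ↦ drvPath_zero ω
  have hmeas : ∀ s, s ≤ t → Measurable[brownianFiltration t] fun ω ↦ drvPath J ρ c ω s := fun _ hs ↦ measurable_drvC_of_le hJ hs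
  have ho : Measurable[brownianFiltration t] (oposC J ρ c t) := measurable_oposC_of_le hJ le_rfl
  have ho0 : ∀ ω, oposC J ρ c t ω ≤ 0 := fun ω ↦ oposC_nonpos t ω
  have hind : Measurable[brownianFiltration t] fun ω ↦ (aliveEv J ρ A c t).indicator (fun _ ↦ (1 : ℝ)) ω :=
    measurable_const.indicator (measurableSet_aliveEv hJ hA.1 hne t)
  have hd : Measurable[brownianFiltration t] fun ω ↦ (aliveEv J ρ A c t).indicator (fun ω ↦ starDeriv (hullC J ρ A c t ω)) ω :=
    measurable_indicator_starDeriv_slidHull (mΩ := brownianFiltration t) (W := drvPath J ρ c) hcW hW0 hmeas hA.1 hne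
  have hE' : Measurable[brownianFiltration t] fun ω ↦
      (aliveEv J ρ A c t).indicator (fun ω ↦ deriv (starMap (hullC J ρ A c t ω)) (oposC J ρ c t ω)) ω :=
    measurable_indicator_deriv_starMap_slidHull_comp (mΩ := brownianFiltration t) (W := drvPath J ρ c) hcW hW0 hmeas hA hne ho ho0
  have hE : Measurable[brownianFiltration t] fun ω ↦
      (aliveEv J ρ A c t).indicator (fun ω ↦ starMap (hullC J ρ A c t ω) (oposC J ρ c t ω)) ω :=
    measurable_indicator_starMap_slidHull_comp (mΩ := brownianFiltration t) (W := drvPath J ρ c) hcW hW0 hmeas hA hne ho ho0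
  have hform : Mraw J ρ A c t = fun ω ↦ (aliveEv J ρ A c t).indicator (fun _ ↦ (1 : ℝ)) ω *
      (if oposC J ρ c t ω < 0 then
        ((aliveEv J ρ A c t).indicator (fun ω ↦ starDeriv (hullC J ρ A c t ω)) ω) ^ (5 / 8 : ℝ) *
          ((aliveEv J ρ A c t).indicator (fun ω ↦ deriv (starMap (hullC J ρ A c t ω)) (oposC J ρ c t ω)) ω).re ^ expB ρ *
          (((aliveEv J ρ A c t).indicator (fun ω ↦ starMap (hullC J ρ A c t ω) (oposC J ρ c t ω)) ω).re / oposC J ρ c t ω) ^ expC ρ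
      else ((aliveEv J ρ A c t).indicator (fun ω ↦ starDeriv (hullC J ρ A c t ω)) ω) ^ sleKappaRhoExponent ρ) :=
    funext fun ω ↦ Mraw_eq_formula hA t ω
  rw [hform]
  refine hind.mul (Measurable.ite (measurableSet_lt ho measurable_const) ?_ (hd.pow_const _))
  exact ((hd.pow_const _).mul ((Complex.measurable_re.comp hE').pow_const _)).mul
    (((Complex.measurable_re.comp hE).div ho).pow_const _)

/-- **`Y` is adapted.** [folklore] -/
theorem adapted_Yc (hJ : IsStronglyProgressive brownianFiltration J) (hA : IsPlusHull A) (hne : A.Nonempty) :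
    Adapted brownianFiltration (Yc J ρ A c) := fun t ↦
  measurable_const.max (measurable_const.min (measurable_Mraw hJ hA hne t))

/-! ### The jets -/

/-- **`ℓ₁ = ∂ₓℓ(E_{B_t})(0, o_t) 𝟙{alive}`.** [cite: LawlerSchrammWerner2003Restriction, proof of Lemma 8.9] -/
def jL1 (J : ℝ≥0 → (ℝ≥0 → ℝ) → ℝ) (ρ : ℝ) (A : Set ℂ) (c : ℝ≥0) (t : ℝ≥0) (ω : ℝ≥0 → ℝ) : ℂ :=
  (aliveEv J ρ A c t).indicator (fun ω ↦ deriv (fun x ↦ ell (starMap (hullC J ρ A c t ω)) ρ x (oposC J ρ c t ω)) 0) ω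

/-- **`ℓ₂ = ∂ₓ²ℓ(E_{B_t})(0, o_t) 𝟙{alive}`.** [cite: LawlerSchrammWerner2003Restriction, proof of Lemma 8.9] -/
def jL2 (J : ℝ≥0 → (ℝ≥0 → ℝ) → ℝ) (ρ : ℝ) (A : Set ℂ) (c : ℝ≥0) (t : ℝ≥0) (ω : ℝ≥0 → ℝ) : ℂ :=
  (aliveEv J ρ A c t).indicator (fun ω ↦ iteratedDeriv 2 (fun x ↦ ell (starMap (hullC J ρ A c t ω)) ρ x (oposC J ρ c t ω)) 0) ω

/-- **`m₁ = ∂_yℓ(E_{B_t})(0, o_t) 𝟙{alive}`.** [cite: LawlerSchrammWerner2003Restriction, proof of Lemma 8.9] -/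
def jM1 (J : ℝ≥0 → (ℝ≥0 → ℝ) → ℝ) (ρ : ℝ) (A : Set ℂ) (c : ℝ≥0) (t : ℝ≥0) (ω : ℝ≥0 → ℝ) : ℂ :=
  (aliveEv J ρ A c t).indicator (fun ω ↦ deriv (fun y ↦ ell (starMap (hullC J ρ A c t ω)) ρ 0 y) (oposC J ρ c t ω)) ω

/-- **`λ = lam E_{B_t} D ρ 0 o_t 𝟙{alive}`** with the glued drift function `D = glueDrift B_t ρ₀`.
[cite: LawlerSchrammWerner2003Restriction, proof of Lemma 8.9 (the dt-terms, via (5.1))] -/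
def jLam (J : ℝ≥0 → (ℝ≥0 → ℝ) → ℝ) (ρ : ℝ) (A : Set ℂ) (c : ℝ≥0) (ρ₀ : ℝ) (t : ℝ≥0) (ω : ℝ≥0 → ℝ) : ℂ :=
  (aliveEv J ρ A c t).indicator (fun ω ↦ lam (starMap (hullC J ρ A c t ω)) (glueDrift (hullC J ρ A c t ω) ρ₀) ρ 0 (oposC J ρ c t ω)) ω

/-- **`ℓ₁` is adapted.** [folklore] -/
theorem adapted_jL1 (hJ : IsStronglyProgressive brownianFiltration J) (hA : IsPlusHull A) (hne : A.Nonempty) :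
    Adapted brownianFiltration (jL1 J ρ A c) := fun t ↦
  measurable_indicator_jetL1_slidHull (mΩ := brownianFiltration t) (W := drvPath J ρ c) (fun ω ↦ continuous_drvPath ω)
    (fun ω ↦ drvPath_zero ω) (fun _ hs ↦ measurable_drvC_of_le hJ hs) hA hne ρ (measurable_oposC_of_le hJ le_rfl)
    fun ω ↦ oposC_nonpos t ω

/-- **`ℓ₂` is adapted.** [folklore] -/
theorem adapted_jL2 (hJ : IsStronglyProgressive brownianFiltration J) (hA : IsPlusHull A) (hne : A.Nonempty) :
    Adapted brownianFiltration (jL2 J ρ A c) := fun t ↦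
  measurable_indicator_jetL2_slidHull (mΩ := brownianFiltration t) (W := drvPath J ρ c) (fun ω ↦ continuous_drvPath ω)
    (fun ω ↦ drvPath_zero ω) (fun _ hs ↦ measurable_drvC_of_le hJ hs) hA hne ρ (measurable_oposC_of_le hJ le_rfl)
    fun ω ↦ oposC_nonpos t ω

/-- Values on the alive event. [folklore] -/
theorem jets_of_mem {t : ℝ≥0} {ω : ℝ≥0 → ℝ} (hω : ω ∈ aliveEv J ρ A c t) (ρ₀ : ℝ) :
    jL1 J ρ A c t ω = deriv (fun x ↦ ell (starMap (hullC J ρ A c t ω)) ρ x (oposC J ρ c t ω)) 0 ∧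
      jL2 J ρ A c t ω = iteratedDeriv 2 (fun x ↦ ell (starMap (hullC J ρ A c t ω)) ρ x (oposC J ρ c t ω)) 0 ∧
      jM1 J ρ A c t ω = deriv (fun y ↦ ell (starMap (hullC J ρ A c t ω)) ρ 0 y) (oposC J ρ c t ω) ∧
      jLam J ρ A c ρ₀ t ω = lam (starMap (hullC J ρ A c t ω)) (glueDrift (hullC J ρ A c t ω) ρ₀) ρ 0 (oposC J ρ c t ω) ∧
      Mraw J ρ A c t ω = oneSidedM ρ (hullC J ρ A c t ω) (oposC J ρ c t ω) :=
  ⟨Set.indicator_of_mem hω _, Set.indicator_of_mem hω _, Set.indicator_of_mem hω _, Set.indicator_of_mem hω _,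
    Set.indicator_of_mem hω _⟩

/-- Values on the dead event. [folklore] -/
theorem jets_of_notMem {t : ℝ≥0} {ω : ℝ≥0 → ℝ} (hω : ω ∉ aliveEv J ρ A c t) (ρ₀ : ℝ) :
    jL1 J ρ A c t ω = 0 ∧ jL2 J ρ A c t ω = 0 ∧ jM1 J ρ A c t ω = 0 ∧ jLam J ρ A c ρ₀ t ω = 0 ∧ Mraw J ρ A c t ω = 0 :=
  ⟨Set.indicator_of_notMem hω _, Set.indicator_of_notMem hω _, Set.indicator_of_notMem hω _, Set.indicator_of_notMem hω _,
    Set.indicator_of_notMem hω _⟩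

/-! ### Locality in the truncation level -/

/-- **Locality**: while the clock is `≤ c ≤ c'`, the processes of levels `c`, `c'` agree at time `t`.
[folklore] -/
theorem locality_of_clock_le (hA : IsStarHull A) {c' : ℝ≥0} {t : ℝ≥0} {ω : ℝ≥0 → ℝ}
    (ht : clock J t ω ≤ (c : ℝ≥0∞)) (hcc' : c ≤ c') (ρ₀ : ℝ) :
    (ω ∈ aliveEv J ρ A c t ↔ ω ∈ aliveEv J ρ A c' t) ∧ Mraw J ρ A c t ω = Mraw J ρ A c' t ω ∧
      Yc J ρ A c t ω = Yc J ρ A c' t ω ∧ jL1 J ρ A c t ω = jL1 J ρ A c' t ω ∧ jL2 J ρ A c t ω = jL2 J ρ A c' t ω ∧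
      jM1 J ρ A c t ω = jM1 J ρ A c' t ω ∧ jLam J ρ A c ρ₀ t ω = jLam J ρ A c' ρ₀ t ω := by
  have heq : ∀ s, s ≤ t → drvPath J ρ c ω s = drvPath J ρ c' ω s := fun s hs ↦ drvC_eq_of_clock_le ht hcc' hs
  have hW := continuous_drvPath (J := J) (ρ := ρ) (c := c) ω
  have hU := continuous_drvPath (J := J) (ρ := ρ) (c := c') ω
  have halive : (ω ∈ aliveEv J ρ A c t ↔ ω ∈ aliveEv J ρ A c' t) :=
    disjoint_closedHull_congr (W := drvPath J ρ c) (U := drvPath J ρ c') hW hU heq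
  have ho : oposC J ρ c t ω = oposC J ρ c' t ω := oposC_eq_of_clock_le ht hcc' le_rfl
  have hM : Mraw J ρ A c t ω = Mraw J ρ A c' t ω := by
    by_cases hω : ω ∈ aliveEv J ρ A c t
    · have hω' := halive.1 hω
      rw [Mraw, Mraw, Set.indicator_of_mem hω, Set.indicator_of_mem hω', hullC, hullC,
        ← slidHull_congr (W := drvPath J ρ c) (U := drvPath J ρ c') hW hU heq hA hω, ho]
    · have hω' : ω ∉ aliveEv J ρ A c' t := fun h ↦ hω (halive.2 h)
      rw [Mraw, Mraw, Set.indicator_of_notMem hω, Set.indicator_of_notMem hω']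
  refine ⟨halive, hM, by rw [Yc, Yc, hM], ?_, ?_, ?_, ?_⟩
  all_goals
    by_cases hω : ω ∈ aliveEv J ρ A c t
    · have hω' := halive.1 hω
      simp only [jL1, jL2, jM1, jLam, Set.indicator_of_mem hω, Set.indicator_of_mem hω', hullC,
        ← slidHull_congr (W := drvPath J ρ c) (U := drvPath J ρ c') hW hU heq hA hω, ho]
    · have hω' : ω ∉ aliveEv J ρ A c' t := fun h ↦ hω (halive.2 h)
      simp only [jL1, jL2, jM1, jLam, Set.indicator_of_notMem hω, Set.indicator_of_notMem hω']

end SLEKappaRho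

end Literature.Probability.RandomPlanarGeometry

end
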